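import Summits.QuantumFields.YangMills.Theorems.BalabanUVNodesK1V6Defs
import Summits.QuantumFields.YangMills.Theorems.BalabanUVNodesK1WindowKOfRunRowsSurvivors

/-!
# IDEA-4 g12 — REV 26ᴿ ITEMS AUDIT, kernel half: the END-EXACT reading of Variant Rʳ's run rows; the CEILING IS NOT LOAD-BEARING FOR THE END
# given runs of every length in every small window; the ∃→∃ (C)-stub shape; K1⁷'s weak `Window` + (iv) + (C) do NOT give the END

Cell `ym-nodeO-ideate`, seat IDEA-4 gen 12 (planner; lens «ideate on items», fourth angle), crux K2⁷ **stmt-QuantumFields-20543**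
`…Theses.BalabanUVNodes.EndpointGivenBR13SepCoPH`.  CRUX WORKFILE (`Cruxes/EndpointGivenBR13SepCoPH/Idea4g12EndExactRowsSketch.lean`), never imported by the tree;
nothing here is filed as an item, no route edit, no registration; counts UNMOVED.  Objects audited: plan g84's drawer `HOME/pub-ymgap-plan/D84-REV26R/`
(`Sketch26R.lean` 6e11740513bc9591: `RunRowsCont13`, `Cont13All`, `K1R8`, `K2R8`, `closes26R`, `k1R8_of_stubTexts_cont`).

WHAT THE END CONSUMER READS.  `Gaps/EndSurvivorCensus.endpointExistence_of_survivorLetters_runwisePS_locUpper` (binders: forward generation, `0 < γ₀`, `0 ≤ M`,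
survivor continuity (C), PER-LEVEL survivor bounds `∃ B_k`, run-wise partial-sum floor `−M`) is the ONLY consumer behind `…K1WindowKOfRunRowsSurvivors` §5, which feeds
row (i) `RunConstRemainder β b r γ₀` into the per-level bound through `survUpper_of_runConstRemainder` — its UPPER half, level by level.  §1 states the END-exact
letters {(i⁺) run-wise per-level ceiling `∃ u`, (iv), (C)} and the bridges `RunRowsCont13 → RunRowsEndExact13 → Window`, `closesEndExact`.
§2 goes one step further (new, [folklore]): in the shooting proof the ceiling is consumed ONLY by `EndRunwiseShooting.seed_of_upper`; a run of length `K`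
inside `]0, g]` IS a seed for the target `g` at every level `γ ≥ g`; so {RUNS OF EVERY LENGTH IN EVERY WINDOW `]0, γ]`, `γ ≤ γ₀` (run currency), (iv), (C)}
⟹ `EndpointExistence C` for every forward-generated `C` — NO β-ceiling at all (`endpointExistence_of_windowRuns_runwisePS_survCont`; Tietze from the
survivor sets WITHOUT bounds, `exists_extension_of_survCont`).  §3: the displays at NODE 00's datum and the K1⁸ variants, each closing the rung with K0⁷ and K3⁷
VERBATIM; the ∃→∃ third-stub shape `RunRowsAtSomeRecord13PWS F → RunRowsContAtSomeRecord13PWS F` composing K1⁸ from the v6 texts, and `Cont13All` ⟹ it.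
§4 (negative, kernel witness `betaKill2`): K1⁷'s displayed WEAK window («some run of some length `K ≥ 1` in every small window») + (iv) + (C) do NOT give the
END — the all-`K` window of §2 (or a ceiling producing it) is what the END reads.

HONEST FRAMING.  Statement shapes, by-name compositions, one Tietze extension and one intermediate-value (sup) argument reused BY NAME from `Gaps/EndRunwiseShooting`;
[folklore] real analysis over the tree's typed carriers.  NOTHING of Bałaban's is asserted: every β-side letter is a HYPOTHESIS SHAPE; [I] = [Balaban1987RG1] Thm 2 p. 259
(first sentence) and (0.31) are NOT proved in print (T09.F) nor here; K0⁷ ∕ K1⁷ ∕ K2⁷ ∕ K3⁷ ∕ K1⁸ are NOT closed by anything in this file; R4 = ONE finite 𝕋⁴ at fixed ε,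
CONDITIONAL rung bookkeeping — NOT the continuum limit, NOT O.S. positivity, NOT a mass gap, NOT Clay.
-/

noncomputable section

open scoped Matrix.Norms.L2Operator

namespace Summit.QuantumFields.YangMills.Cruxes.EndpointGivenBR13SepCoPH.Idea4g12

open Literature.MathematicalPhysics.QuantumFieldTheory.Balaban1983to89
open Literature.MathematicalPhysics.QuantumFieldTheory.Balaban1983to89.FlowStep
open Literature.MathematicalPhysics.QuantumFieldTheory.Balaban1983to89.FlowStepRuns
open Literature.MathematicalPhysics.QuantumFieldTheory.Balaban1983to89.DagBinding
open Literature.MathematicalPhysics.QuantumFieldTheory.Balaban1983to89.T4Continuum (T4Family FiniteEpsData)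
open Summit.QuantumFields.YangMills.Theorems.BalabanUVNodesK2NamedJetsRunRemAt (Survivors RunConstRemainder SurvCont run_of_survivor survUpper_of_runConstRemainder)
open Summit.QuantumFields.YangMills.Theorems.K1V6Defs (RecordS Inhabited13 NodesAtSomeRecord13PWS Window RunRowsAtSomeRecord13PWS)
open Summit.QuantumFields.YangMills.BalabanUVNodes.K1EndOfNodes13PWSOfRunRemAt (stabilityB_body_of_rung1At_of_runLetters)
open Summit.QuantumFields.YangMills.BalabanUVNodes.K1RunRowsOfBoxAndPartialSums (runwisePS_mono)
open Summit.QuantumFields.YangMills.Theorems.BalabanUVNodesK1WindowKOfRunRows (runwiseCeiling_of_runConstRemainder windowK_uniform_of_forwardGenerated_of_runwiseCeiling)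
open Summit.QuantumFields.YangMills.Theorems.BalabanUVNodesK1WindowKOfRunRowsSurvivors (runwisePS_nonneg endpointExistence_datumOfRecord₁₃SepCoPH_of_runRows_survCont)
open Summit.QuantumFields.BalabanUV.Gaps.EndSurvivorCensus (endpointExistence_of_survivorLetters_runwisePS_locUpper)
open Summit.QuantumFields.BalabanUV.Gaps.EndSurvivorExtension (extH extH_apply betaContH_extH rgEqH_extH_of_rgEqH rgEqH_of_rgEqH_extH runwisePS_extH isClosed_survivors clampPrefix_zero)
open Summit.QuantumFields.BalabanUV.Gaps.EndRunwiseShooting (shooting_dichotomy inInterval_shoot rgEqH_shoot_of_survives shoot_eq_of_Y_eq shoot_eq_top_of_Y_eq windowSum_shoot Y_eq_of_run survives_of_run)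
open Summit.QuantumFields.BalabanUV.Gaps.EndContAlongFoliation (endpointExistence_of_runs)
open Summit.QuantumFields.YangMills.Theses.BalabanUVNodes

/-! ## §1 The END-EXACT letters (generic `β`, any forward-generated `C`): run-wise per-level CEILING `∃ u` (row (i⁺)), floor (iv), (C) -/

section EndExact

variable {β : HBeta}

/-- A RUN-WISE PER-LEVEL CEILING read on the survivor traces: `β_k(clampPrefix β γ₀ k x) ≤ u_k` at every survivor `x` of level `γ₀` at scale `k` (survivors are runs,
`run_of_survivor`).  The `hsl` letter of Gaps' `_locUpper` road from row (i⁺) alone — no lower half, no `k`-uniform constant. [folklore] -/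
theorem survUpper_of_runwiseCeiling {u : ℕ → ℝ} {γ₀ : ℝ} (hγ₀ : 0 < γ₀)
    (hup : ∀ (n : ℕ) (gs : ℕ → ℝ), RGEqH n β gs → Step.InInterval γ₀ n gs → ∀ k, k ≤ n → β k (prefixOf gs k) ≤ u k)
    (k : ℕ) (x : ℝ) (hx0 : 0 < x) (hxγ : x ≤ γ₀) (hsurv : ∀ j, j ≤ k → 1 / γ₀ ^ 2 ≤ Y β γ₀ j x) :
    β k (clampPrefix β γ₀ k x) ≤ u k := by
  obtain ⟨hrg, hI⟩ := run_of_survivor (β := β) hγ₀ ⟨hx0, hxγ, hsurv⟩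
  have h1 := hup k _ hrg hI k le_rfl
  have e : prefixOf (fun i => gClamp γ₀ (Y β γ₀ i x)) k = clampPrefix β γ₀ k x := rfl
  rwa [e] at h1

/-- ★ **THE END FROM THE END-EXACT LETTERS** {(i⁺) run-wise per-level ceiling, (iv) run-wise partial-sum floor, (C) survivor continuity} at one level `γ₀ > 0`, for every
forward-generated `C` — Gaps' `endpointExistence_of_survivorLetters_runwisePS_locUpper` BY NAME (`0 ≤ M` from (iv) by `runwisePS_nonneg`).  This is EXACTLY what
`…K1WindowKOfRunRowsSurvivors.endpointExistence_of_runConstRemainder_runwisePS_survCont` reads of row (i) (`u k := b k + r`).  CONDITIONAL on three displayed letters.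
[cite: Balaban1987RG1, Thm 2 p.259 (first sentence), Thm 3 p.264, §1 pp.263–264 (bookkeeping)] -/
theorem endpointExistence_of_runwiseCeiling_runwisePS_survCont {C : B12.Construction} (hgen : ForwardGenerated C β) {u : ℕ → ℝ} {γ₀ M : ℝ} (hγ₀ : 0 < γ₀)
    (hup : ∀ (n : ℕ) (gs : ℕ → ℝ), RGEqH n β gs → Step.InInterval γ₀ n gs → ∀ k, k ≤ n → β k (prefixOf gs k) ≤ u k)
    (hps : ∀ (n : ℕ) (gs : ℕ → ℝ), RGEqH n β gs → Step.InInterval γ₀ n gs → ∀ k, k ≤ n → -M ≤ ∑ j ∈ Finset.Ico k n, β j (prefixOf gs j))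
    (hsc : SurvCont β γ₀) : EndpointExistence C :=
  endpointExistence_of_survivorLetters_runwisePS_locUpper hgen hγ₀ (runwisePS_nonneg hγ₀ hps) hsc
    (fun k => ⟨u k, fun x hx0 hxγ hsurv => survUpper_of_runwiseCeiling hγ₀ hup k x hx0 hxγ hsurv⟩) hps

end EndExact

/-! ## §2 THE CEILING IS NOT LOAD-BEARING FOR THE END: runs of every length in every small window ARE the seeds of the shooting argument -/

section CeilingFree

variable {β : HBeta}

/-- **TIETZE IN THE BARE COUPLING, UNBOUNDED**: if every trace `x ↦ β_k(clampPrefix β γ₀ k x)` is continuous on its survivor set `S_k` (relatively closed in the normal space `]0, γ₀]`,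
`EndSurvivorExtension.isClosed_survivors`), there is a table `F` of functions continuous on ALL of `]0, γ₀]` agreeing with the traces on the survivor sets — Mathlib's
`ContinuousMap.exists_restrict_eq` (real-valued Tietze, no bound asked, none delivered).  The tree's `exists_extension_of_survivorLetters` minus its bound letter. [folklore] -/
theorem exists_extension_of_survCont {γ₀ : ℝ}
    (hsc : ∀ k : ℕ, ContinuousOn (fun x : ℝ => β k (clampPrefix β γ₀ k x)) {x : ℝ | 0 < x ∧ x ≤ γ₀ ∧ ∀ j, j ≤ k → 1 / γ₀ ^ 2 ≤ Y β γ₀ j x}) :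
    ∃ F : ℕ → ℝ → ℝ, (∀ k : ℕ, ContinuousOn (F k) (Set.Ioc 0 γ₀)) ∧
      ∀ (k : ℕ) (x : ℝ), 0 < x → x ≤ γ₀ → (∀ j, j ≤ k → 1 / γ₀ ^ 2 ≤ Y β γ₀ j x) → F k x = β k (clampPrefix β γ₀ k x) := by
  have key : ∀ k : ℕ, ∃ Fk : ℝ → ℝ, ContinuousOn Fk (Set.Ioc 0 γ₀) ∧
      ∀ x : ℝ, 0 < x → x ≤ γ₀ → (∀ j, j ≤ k → 1 / γ₀ ^ 2 ≤ Y β γ₀ j x) → Fk x = β k (clampPrefix β γ₀ k x) := by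
    intro k
    let s : Set (Set.Ioc (0 : ℝ) γ₀) := {p | ∀ j, j ≤ k → 1 / γ₀ ^ 2 ≤ Y β γ₀ j p.1}
    have hs : IsClosed s := isClosed_survivors hsc k
    have hf : Continuous fun q : s => β k (clampPrefix β γ₀ k q.1.1) :=
      (hsc k).comp_continuous (continuous_subtype_val.comp continuous_subtype_val) fun q => ⟨q.1.2.1, q.1.2.2, q.2⟩
    let f : C(s, ℝ) := ⟨fun q => β k (clampPrefix β γ₀ k q.1.1), hf⟩
    have hfq : ∀ q : s, f q = β k (clampPrefix β γ₀ k q.1.1) := fun q => rfl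
    obtain ⟨g, hgf⟩ := ContinuousMap.exists_restrict_eq hs f
    refine ⟨fun x => if h : 0 < x ∧ x ≤ γ₀ then g ⟨x, h⟩ else 0, ?_, ?_⟩
    · rw [continuousOn_iff_continuous_restrict]
      have e : (Set.Ioc (0 : ℝ) γ₀).restrict (fun x => if h : 0 < x ∧ x ≤ γ₀ then g ⟨x, h⟩ else 0) = g := by
        funext p
        have hp : 0 < (p : ℝ) ∧ (p : ℝ) ≤ γ₀ := p.2
        simp only [Set.restrict_apply, dif_pos hp, Subtype.coe_eta]
      rw [e]
      exact g.continuous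
    · intro x hx hxγ hsurv
      have h : 0 < x ∧ x ≤ γ₀ := ⟨hx, hxγ⟩
      simp only [dif_pos h]
      have := congrArg (fun φ : C(s, ℝ) => φ ⟨⟨x, h⟩, hsurv⟩) hgf
      simpa [hfq] using this
  choose F hF using key
  exact ⟨F, fun k => (hF k).1, fun k => (hF k).2⟩

variable {γ : ℝ}

/-- **A RUN OF LENGTH `K` INSIDE `]0, g]` IS A SEED for the target `g` at every level `γ ≥ g`**: its initial coupling `x_s := g_0 ∈ ]0, g]` has a clamped level-`γ` trajectory that IS the
run (`EndRunwiseShooting.Y_eq_of_run`), hence survives to `K` in `]0, γ]` and ends at or below `g` (`1∕g² ≤ 1∕g_K² = Y_K(x_s)`).  This is the ONLY thing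
`EndRunwiseShooting.seed_of_upper` produced from the ceiling `β ≤ β′`. [folklore] -/
theorem seed_of_windowRun {K : ℕ} {g : ℝ} (hgγ : g ≤ γ) {gs : ℕ → ℝ} (hrg : RGEqH K β gs) (hI : Step.InInterval g K gs) :
    ∃ xs : ℝ, 0 < xs ∧ xs ≤ g ∧ (∀ k, k ≤ K → 1 / γ ^ 2 ≤ Y β γ k xs) ∧ 1 / g ^ 2 ≤ Y β γ K xs := by
  have hIγ : Step.InInterval γ K gs := fun k hk => ⟨(hI k hk).1, (hI k hk).2.trans hgγ⟩
  refine ⟨gs 0, (hI 0 (Nat.zero_le _)).1, (hI 0 (Nat.zero_le _)).2, survives_of_run hrg hIγ, ?_⟩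
  rw [(Y_eq_of_run (γ := γ) hrg hIγ K le_rfl).1]
  exact one_div_le_one_div_of_le (pow_pos (hI K le_rfl).1 2) (pow_le_pow_left₀ (hI K le_rfl).1.le (hI K le_rfl).2 2)

/-- `EndRunwiseShooting.run_dichotomy` WITH THE SEED AS HYPOTHESIS (no `β ≤ β′`): `β` continuous on the boxes `]0,γ]^{k+1}`, a seed for `(K, g)`; EITHER an in-interval solution of (0.20) of
length `K` ends exactly at `g`, OR one sits at `γ` at some step `k ≤ K`, ends strictly below `g`, and its window sum `Σ_{j∈[k,K)} β_j` is `< 1∕γ² − 1∕g²`.  Proof = the tree's, after its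
first line (`shooting_dichotomy` BY NAME). [folklore] -/
theorem run_dichotomy_of_seed (hγ : 0 < γ) (hcont : BetaContH γ β) (K : ℕ) {g : ℝ} (hg : 0 < g) (hgγ : g ≤ γ)
    {xs : ℝ} (hxs : 0 < xs) (hxsg : xs ≤ g) (hsv : ∀ k, k ≤ K → 1 / γ ^ 2 ≤ Y β γ k xs) (hendK : 1 / g ^ 2 ≤ Y β γ K xs) :
    (∃ gs : ℕ → ℝ, gs K = g ∧ RGEqH K β gs ∧ Step.InInterval γ K gs) ∨
    (∃ gs : ℕ → ℝ, RGEqH K β gs ∧ Step.InInterval γ K gs ∧ gs K < g ∧ ∃ k, k ≤ K ∧ gs k = γ ∧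
        ∑ j ∈ Finset.Ico k K, β j (prefixOf gs j) < 1 / γ ^ 2 - 1 / g ^ 2) := by
  rcases shooting_dichotomy hγ hcont hxs (hxsg.trans hgγ) ⟨hsv, hendK⟩ with
    ⟨x, -, -, hsurv, hY⟩ | ⟨x, -, -, hsurv, hlt, k, hk, hYk⟩
  · exact Or.inl ⟨fun k => gClamp γ (Y β γ k x), shoot_eq_of_Y_eq hg hY (hsurv K le_rfl),
      rgEqH_shoot_of_survives hγ hsurv, inInterval_shoot hγ K x⟩
  · right
    refine ⟨fun k => gClamp γ (Y β γ k x), rgEqH_shoot_of_survives hγ hsurv, inInterval_shoot hγ K x, ?_, k, hk,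
      shoot_eq_top_of_Y_eq hγ hYk, ?_⟩
    · have hYK : 1 / (gClamp γ (Y β γ K x)) ^ 2 = Y β γ K x := inv_sq_gClamp hγ (hsurv K le_rfl)
      have hpos : 0 < gClamp γ (Y β γ K x) := gClamp_pos hγ _
      by_contra hge
      have hge' : g ≤ gClamp γ (Y β γ K x) := not_lt.mp hge
      have : 1 / (gClamp γ (Y β γ K x)) ^ 2 ≤ 1 / g ^ 2 :=
        one_div_le_one_div_of_le (by positivity) (pow_le_pow_left₀ hg.le hge' 2)
      linarith
    · rw [windowSum_shoot k K hk x, hYk]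
      linarith

/-- ★ **RUN-WISE SUFFICIENCY WITHOUT A CEILING**: `β` continuous on the boxes `]0,γ]^{k+1}`, RUNS OF EVERY LENGTH INSIDE `]0, g]` FOR EVERY `g ∈ ]0, γ]` (run currency), and the run-wise
partial-sum floor `−M` along the in-`]0,γ]` runs ⟹ for every `K` and every target `g` with `1∕g² ≥ 1∕γ² + M` an in-interval run of (0.20) ends EXACTLY at `g_K = g` (the touching
alternative would have window sum `< −M`).  = `EndRunwiseShooting.couplingTrajectory_exists_of_topRuns` with `seed_of_upper` replaced by `seed_of_windowRun`. [folklore] -/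
theorem couplingTrajectory_exists_of_windowRuns_runwisePS (β : HBeta) {γ M : ℝ} (hγ : 0 < γ) (hcont : BetaContH γ β)
    (hwin : ∀ g : ℝ, 0 < g → g ≤ γ → ∀ K : ℕ, ∃ gs : ℕ → ℝ, RGEqH K β gs ∧ Step.InInterval g K gs)
    (hrun : ∀ (n : ℕ) (gs : ℕ → ℝ), RGEqH n β gs → Step.InInterval γ n gs → ∀ k, k ≤ n → -M ≤ ∑ j ∈ Finset.Ico k n, β j (prefixOf gs j)) :
    ∀ (K : ℕ) (g : ℝ), 0 < g → 1 / γ ^ 2 + M ≤ 1 / g ^ 2 → ∃ gs : ℕ → ℝ, gs K = g ∧ RGEqH K β gs ∧ Step.InInterval γ K gs := by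
  intro K g hg hgM
  have hM : 0 ≤ M := by
    obtain ⟨gs, hrg, hI⟩ := hwin γ hγ le_rfl 0
    have h0 := hrun 0 gs hrg hI 0 le_rfl
    simp only [Finset.Ico_self, Finset.sum_empty] at h0
    linarith
  have hγg : 1 / γ ^ 2 ≤ 1 / g ^ 2 := by linarith
  have hgγ : g ≤ γ := by
    have h2 : g ^ 2 ≤ γ ^ 2 := by rwa [one_div_le_one_div (by positivity) (by positivity)] at hγg
    nlinarith [hg, hγ]
  obtain ⟨gs₀, hrg₀, hI₀⟩ := hwin g hg hgγ K
  obtain ⟨xs, hxs, hxsg, hsv, hendK⟩ := seed_of_windowRun (β := β) (γ := γ) hgγ hrg₀ hI₀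
  rcases run_dichotomy_of_seed hγ hcont K hg hgγ hxs hxsg hsv hendK with h | ⟨gs, hrg, hI, -, k, hk, -, hsum⟩
  · exact h
  · exfalso
    have := hrun K gs hrg hI k hk
    linarith

/-- ★★ **THE END WITHOUT A CEILING, BOX-CONTINUITY FORM** (every forward-generated `C`): `β` continuous on the boxes `]0,γ₀]^{k+1}`, runs of EVERY length inside EVERY window `]0, γ]`,
`γ ∈ ]0, γ₀]` (run currency: `RGEqH K β gs ∧ Step.InInterval γ K gs`), and the run-wise partial-sum floor `−M` at level `γ₀` ⟹ `DagBinding.EndpointExistence C`, with `γ₂ := γ₀`,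
`g⋆ := (1∕γ² + M)^{−1∕2}`.  Assembly = `EndRunwiseShooting.endpointExistence_of_topRunsPerLevel`'s with the ceiling-free trajectory theorem. [cite: Balaban1987RG1, Thm 2 p.259 (first sentence) and (0.17)–(0.20) pp.255–256 (elementary consequence; nothing of the theorem asserted)] -/
theorem endpointExistence_of_windowRuns_runwisePS_betaContH {C : B12.Construction} (hgen : ForwardGenerated C β) {γ₀ M : ℝ} (hγ₀ : 0 < γ₀) (hcont : BetaContH γ₀ β)
    (hwin : ∀ γ : ℝ, 0 < γ → γ ≤ γ₀ → ∀ K : ℕ, ∃ gs : ℕ → ℝ, RGEqH K β gs ∧ Step.InInterval γ K gs)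
    (hrun : ∀ (n : ℕ) (gs : ℕ → ℝ), RGEqH n β gs → Step.InInterval γ₀ n gs → ∀ k, k ≤ n → -M ≤ ∑ j ∈ Finset.Ico k n, β j (prefixOf gs j)) :
    EndpointExistence C := by
  have hM : 0 ≤ M := runwisePS_nonneg hγ₀ hrun
  intro m
  refine ⟨γ₀, hγ₀, fun γ hγ hγle => ?_⟩
  set gstar : ℝ := 1 / Real.sqrt (1 / γ ^ 2 + M) with hgstar
  have hgstar_pos : 0 < gstar := by positivity
  refine ⟨gstar, hgstar_pos, fun g hg hgle K => ?_⟩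
  have hgs : 1 / gstar ^ 2 = 1 / γ ^ 2 + M := by
    rw [hgstar, div_pow, one_pow, Real.sq_sqrt (by positivity), one_div_one_div]
  have hgM : 1 / γ ^ 2 + M ≤ 1 / g ^ 2 := by
    rw [← hgs]
    exact one_div_le_one_div_of_le (by positivity) (pow_le_pow_left₀ hg.le hgle 2)
  have hcont' : BetaContH γ β := fun k => (hcont k).mono (box_mono hγle k)
  have hwin' : ∀ g' : ℝ, 0 < g' → g' ≤ γ → ∀ K : ℕ, ∃ gs : ℕ → ℝ, RGEqH K β gs ∧ Step.InInterval g' K gs :=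
    fun g' hg' hg'le K => hwin g' hg' (hg'le.trans hγle) K
  obtain ⟨gs, hgsK, hrg, hI⟩ := couplingTrajectory_exists_of_windowRuns_runwisePS β hγ hcont' hwin' (runwisePS_mono hγle hrun) K g hg hgM
  have heq : ∀ k, k ≤ K → (C ⟨K, m, gs 0⟩).flow.g k = gs k :=
    flow_eq_of_rgEqH (C ⟨K, m, gs 0⟩).flow β K (fun k hk => hgen.2 ⟨K, m, gs 0⟩ k hk)
      (hgen.1 ⟨K, m, gs 0⟩) hrg (fun k hk => (hI k hk).1)
  refine ⟨gs 0, fun k hk => ?_, ?_⟩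
  · rw [heq k hk]; exact hI k hk
  · rw [heq K le_rfl]; exact hgsK

/-- ★★★ **THE END WITHOUT A CEILING, SURVIVOR FORM — THE END-MINIMAL β-SIDE LETTERS** (every forward-generated `C`): {RUNS OF EVERY LENGTH IN EVERY WINDOW `]0, γ]`, `γ ≤ γ₀` (run currency),
(iv) the run-wise partial-sum floor `−M` at level `γ₀`, (C) survivor continuity `SurvCont β γ₀`} ⟹ `DagBinding.EndpointExistence C`.  NO per-level bound, NO remainder, NO sign.
Proof: Tietze WITHOUT bounds (`exists_extension_of_survCont`) gives a table `F` continuous on `]0,γ₀]` agreeing with the traces on the survivor sets; `extH F` has THE SAME in-interval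
runs at every level `≤ γ₀` (`rgEqH_extH_of_rgEqH` ∕ `rgEqH_of_rgEqH_extH`), so the window runs and the floor transfer to it, the box form gives the END of `modelOf (extH F)`, and
`EndContAlongFoliation.endpointExistence_of_runs` carries it to `C`.  So of Variant Rʳ's row (i) the END needs NOTHING but the runs it produces. [cite: Balaban1987RG1, Thm 2 p.259 (first sentence), (0.17)–(0.20) pp.255–256, §1 pp.263–264 (elementary consequence; nothing of the theorem asserted)] -/
theorem endpointExistence_of_windowRuns_runwisePS_survCont {C : B12.Construction} (hgen : ForwardGenerated C β) {γ₀ M : ℝ} (hγ₀ : 0 < γ₀)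
    (hwin : ∀ γ : ℝ, 0 < γ → γ ≤ γ₀ → ∀ K : ℕ, ∃ gs : ℕ → ℝ, RGEqH K β gs ∧ Step.InInterval γ K gs)
    (hrun : ∀ (n : ℕ) (gs : ℕ → ℝ), RGEqH n β gs → Step.InInterval γ₀ n gs → ∀ k, k ≤ n → -M ≤ ∑ j ∈ Finset.Ico k n, β j (prefixOf gs j))
    (hsc : SurvCont β γ₀) : EndpointExistence C := by
  obtain ⟨F, hFc, hagree⟩ := exists_extension_of_survCont hsc
  have hwin' : ∀ γ : ℝ, 0 < γ → γ ≤ γ₀ → ∀ K : ℕ, ∃ gs : ℕ → ℝ, RGEqH K (extH F) gs ∧ Step.InInterval γ K gs := by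
    intro γ hγ hγle K
    obtain ⟨gs, hrg, hI⟩ := hwin γ hγ hγle K
    exact ⟨gs, rgEqH_extH_of_rgEqH hγle hagree hrg hI, hI⟩
  exact endpointExistence_of_runs hγ₀ (modelOf_forwardGenerated _) (modelOf_haltsOutside _) (modelOf_curries _) hgen
    (fun _ _ hγle _ _ hI hrg => rgEqH_of_rgEqH_extH hγle hagree hrg hI)
    (endpointExistence_of_windowRuns_runwisePS_betaContH (modelOf_forwardGenerated (extH F)) hγ₀ (betaContH_extH hFc) hwin' (runwisePS_extH hagree hrun))

/-- Row (i⁺) ⟹ the window runs (run currency), at the canonical construction `modelOf β` read back as runs: a run-wise per-level ceiling gives, for every `γ ∈ ]0, γ₀]` and every `K`, an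
in-`]0,γ]` solution of (0.20) of length `K` (`…K1WindowKOfRunRows.windowK_uniform_of_forwardGenerated_of_runwiseCeiling` at `modelOf β`).  So §1 is §2 + the ladder. [cite: Balaban1987RG1, (0.17)–(0.20) pp.255–256 and Thm 3 p.264 (elementary consequence)] -/
theorem windowRuns_of_runwiseCeiling {u : ℕ → ℝ} {γ₀ : ℝ}
    (hup : ∀ (n : ℕ) (gs : ℕ → ℝ), RGEqH n β gs → Step.InInterval γ₀ n gs → ∀ k, k ≤ n → β k (prefixOf gs k) ≤ u k) :
    ∀ γ : ℝ, 0 < γ → γ ≤ γ₀ → ∀ K : ℕ, ∃ gs : ℕ → ℝ, RGEqH K β gs ∧ Step.InInterval γ K gs := by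
  intro γ hγ hγle K
  obtain ⟨g0, -, hI, hrg⟩ := windowK_uniform_of_forwardGenerated_of_runwiseCeiling (modelOf β) β (modelOf_forwardGenerated β) hup γ hγ hγle K 0
  exact ⟨((modelOf β) ⟨K, 0, g0⟩).flow.g, hrg, hI⟩

end CeilingFree

/-! ## §3 AT NODE 00's STAGE-13 DATUM: the displays, the bridges, the K1⁸ variants with their `closes`, the ∃→∃ (C)-stub shape -/

section Record

variable {F : T4Family}

/-- Variant Rʳ's rows conjunct, VERBATIM from plan g84's `Sketch26R.lean` l.40–44 (`RunRowsCont13`): rows (i) run-wise constant remainder, (iv) run-wise partial-sum floor, (C) survivor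
continuity of the record's β at ONE level `γ₀ > 0`; `b r γ₀ M` ∃-side.  Copied so that the bridges below are kernel statements about THAT text. [cite: Balaban1987RG1, Thm 3 p.264, (1.20)–(1.22) p.264, (5.10) p.293, §1 pp.263–264 (bookkeeping)] -/
def RunRowsCont13 (F : T4Family) (θ : Node00.Stage13HParams F 2) : Prop :=
  ∃ (b : ℕ → ℝ) (r γ₀ M : ℝ), 0 < γ₀ ∧ RunConstRemainder (Node00.betaOfRecord₁₃ F 2 θ.toStage13Params) b r γ₀ ∧
    (∀ (n : ℕ) (gs : ℕ → ℝ), RGEqH n (Node00.betaOfRecord₁₃ F 2 θ.toStage13Params) gs → Step.InInterval γ₀ n gs →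
      ∀ k, k ≤ n → -M ≤ ∑ j ∈ Finset.Ico k n, Node00.betaOfRecord₁₃ F 2 θ.toStage13Params j (prefixOf gs j)) ∧
    SurvCont (Node00.betaOfRecord₁₃ F 2 θ.toStage13Params) γ₀

/-- **THE END-EXACT ROWS** (what `…locUpper` reads of Rʳ's rows, nothing more): (i⁺) a run-wise PER-LEVEL CEILING `∃ u : ℕ → ℝ` (the UPPER half of (i), level by level — no lower half, no
`k`-uniform `r`), (iv), (C), at one level `γ₀ > 0`. [cite: Balaban1987RG1, Thm 3 p.264, (5.10) p.293, §1 pp.263–264 (bookkeeping)] -/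
def RunRowsEndExact13 (F : T4Family) (θ : Node00.Stage13HParams F 2) : Prop :=
  ∃ (u : ℕ → ℝ) (γ₀ M : ℝ), 0 < γ₀ ∧
    (∀ (n : ℕ) (gs : ℕ → ℝ), RGEqH n (Node00.betaOfRecord₁₃ F 2 θ.toStage13Params) gs → Step.InInterval γ₀ n gs →
      ∀ k, k ≤ n → Node00.betaOfRecord₁₃ F 2 θ.toStage13Params k (prefixOf gs k) ≤ u k) ∧
    (∀ (n : ℕ) (gs : ℕ → ℝ), RGEqH n (Node00.betaOfRecord₁₃ F 2 θ.toStage13Params) gs → Step.InInterval γ₀ n gs →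
      ∀ k, k ≤ n → -M ≤ ∑ j ∈ Finset.Ico k n, Node00.betaOfRecord₁₃ F 2 θ.toStage13Params j (prefixOf gs j)) ∧
    SurvCont (Node00.betaOfRecord₁₃ F 2 θ.toStage13Params) γ₀

/-- **THE END-MINIMAL ROWS** (§2): NO β-ceiling at all — (w⁺) in-`]0,γ]` solutions of (0.20) of EVERY length for EVERY `γ ≤ γ₀` (run currency), (iv), (C). [cite: Balaban1987RG1, (0.17)–(0.20) pp.255–256, Thm 2 p.259 (first sentence), §1 pp.263–264 (bookkeeping)] -/
def RunRowsWin13 (F : T4Family) (θ : Node00.Stage13HParams F 2) : Prop :=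
  ∃ (γ₀ M : ℝ), 0 < γ₀ ∧
    (∀ γ : ℝ, 0 < γ → γ ≤ γ₀ → ∀ K : ℕ, ∃ gs : ℕ → ℝ, RGEqH K (Node00.betaOfRecord₁₃ F 2 θ.toStage13Params) gs ∧ Step.InInterval γ K gs) ∧
    (∀ (n : ℕ) (gs : ℕ → ℝ), RGEqH n (Node00.betaOfRecord₁₃ F 2 θ.toStage13Params) gs → Step.InInterval γ₀ n gs →
      ∀ k, k ≤ n → -M ≤ ∑ j ∈ Finset.Ico k n, Node00.betaOfRecord₁₃ F 2 θ.toStage13Params j (prefixOf gs j)) ∧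
    SurvCont (Node00.betaOfRecord₁₃ F 2 θ.toStage13Params) γ₀

/-- Rʳ's rows ⟹ the END-exact rows (`u k := b k + r`, `runwiseCeiling_of_runConstRemainder`): the END-exact display is WEAKER. [cite: Balaban1987RG1, Thm 3 p.264 and (1.20)–(1.22) p.264 (bookkeeping)] -/
theorem runRowsEndExact13_of_runRowsCont13 (θ : Node00.Stage13HParams F 2) (h : RunRowsCont13 F θ) : RunRowsEndExact13 F θ := by
  obtain ⟨b, r, γ₀, M, hγ₀, hrem, hps, hsc⟩ := h
  exact ⟨fun k => b k + r, γ₀, M, hγ₀, runwiseCeiling_of_runConstRemainder hrem, hps, hsc⟩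

/-- The END-exact rows ⟹ the END-minimal rows (the ladder, `windowRuns_of_runwiseCeiling`): weaker still. [cite: Balaban1987RG1, (0.17)–(0.20) pp.255–256 and Thm 3 p.264 (elementary consequence)] -/
theorem runRowsWin13_of_runRowsEndExact13 (θ : Node00.Stage13HParams F 2) (h : RunRowsEndExact13 F θ) : RunRowsWin13 F θ := by
  obtain ⟨u, γ₀, M, hγ₀, hup, hps, hsc⟩ := h
  exact ⟨γ₀, M, hγ₀, windowRuns_of_runwiseCeiling hup, hps, hsc⟩

/-- ★ **THE END-MINIMAL ROWS AT THE DATUM ⟹ K2⁷'s CONSEQUENT** `EndpointExistence (datumOfRecord₁₃SepCoPH F 2 θ h).C.toB12` (the datum is forward-generated by its β of record, `(datum).fwd`,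
`(datum).βfun = betaOfRecord₁₃ θ` by `rfl`).  CONDITIONAL on the displayed letters; K2⁷ NOT closed. [cite: Balaban1987RG1, Thm 2 p.259 (first sentence), (0.17)–(0.20) pp.255–256; Balaban1989LargeFieldII, Thm 1 p.355 (bookkeeping)] -/
theorem endpointExistence_datumOfRecord₁₃SepCoPH_of_runRowsWin13 (θ : Node00.Stage13HParams F 2) (h : θ.Provisos₁₃SepCoPH F 2) (hrows : RunRowsWin13 F θ) :
    EndpointExistence (Node00.datumOfRecord₁₃SepCoPH F 2 θ h).C.toB12 := by
  obtain ⟨γ₀, M, hγ₀, hwin, hps, hsc⟩ := hrows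
  exact endpointExistence_of_windowRuns_runwisePS_survCont (Node00.datumOfRecord₁₃SepCoPH F 2 θ h).fwd hγ₀ hwin hps hsc

/-- … hence from the END-exact rows (`…locUpper` road, §1) … [cite: Balaban1987RG1, Thm 2 p.259 (first sentence); Balaban1989LargeFieldII, Thm 1 p.355 (bookkeeping)] -/
theorem endpointExistence_datumOfRecord₁₃SepCoPH_of_runRowsEndExact13 (θ : Node00.Stage13HParams F 2) (h : θ.Provisos₁₃SepCoPH F 2) (hrows : RunRowsEndExact13 F θ) :
    EndpointExistence (Node00.datumOfRecord₁₃SepCoPH F 2 θ h).C.toB12 := by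
  obtain ⟨u, γ₀, M, hγ₀, hup, hps, hsc⟩ := hrows
  exact endpointExistence_of_runwiseCeiling_runwisePS_survCont (Node00.datumOfRecord₁₃SepCoPH F 2 θ h).fwd hγ₀ hup hps hsc

/-- … and from Rʳ's rows (this is `Sketch26R.k2R8_holds`' content, re-derived through the weaker displays). [cite: Balaban1987RG1, Thm 2 p.259 (first sentence); Balaban1989LargeFieldII, Thm 1 p.355 (bookkeeping)] -/
theorem endpointExistence_datumOfRecord₁₃SepCoPH_of_runRowsCont13 (θ : Node00.Stage13HParams F 2) (h : θ.Provisos₁₃SepCoPH F 2) (hrows : RunRowsCont13 F θ) :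
    EndpointExistence (Node00.datumOfRecord₁₃SepCoPH F 2 θ h).C.toB12 :=
  endpointExistence_datumOfRecord₁₃SepCoPH_of_runRowsEndExact13 θ h (runRowsEndExact13_of_runRowsCont13 θ hrows)

/-- **K1⁷'s `Window D` IS IMPLIED BY THE ROWS** (already by the END-minimal rows: the length-1 run at each level, read as the datum's run `⟨1, 0, g_0⟩` by forward generation): in K1⁸ the
conjunct `Window (datum)` displayed next to `RunRowsCont13 F θ` carries no independent content. [cite: Balaban1988Convergent, (0.4) p.235; Balaban1987RG1, (0.17)–(0.20) pp.255–256 (bookkeeping)] -/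
theorem window_of_runRowsWin13 (θ : Node00.Stage13HParams F 2) (hP : θ.Provisos₁₃SepCoPH F 2) (hrows : RunRowsWin13 F θ) :
    Window (Node00.datumOfRecord₁₃SepCoPH F 2 θ hP) := by
  obtain ⟨γ₀, M, hγ₀, hwin, -, -⟩ := hrows
  refine ⟨γ₀, hγ₀, fun γ hγ hγle => ?_⟩
  obtain ⟨gs, hrg, hI⟩ := hwin γ hγ hγle 1
  set D := Node00.datumOfRecord₁₃SepCoPH F 2 θ hP with hD
  have heq : ∀ k, k ≤ 1 → (D.C.toB12 ⟨1, 0, gs 0⟩).flow.g k = gs k :=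
    flow_eq_of_rgEqH (D.C.toB12 ⟨1, 0, gs 0⟩).flow (Node00.betaOfRecord₁₃ F 2 θ.toStage13Params) 1 (fun k hk => D.fwd.2 ⟨1, 0, gs 0⟩ k hk)
      (D.fwd.1 ⟨1, 0, gs 0⟩) hrg (fun k hk => (hI k hk).1)
  refine ⟨⟨1, 0, gs 0⟩, le_rfl, fun k hk => ?_⟩
  show 0 < (D.C.toB12 ⟨1, 0, gs 0⟩).flow.g k ∧ (D.C.toB12 ⟨1, 0, gs 0⟩).flow.g k ≤ γ
  rw [heq k hk]; exact hI k hk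

/-- … so from the END-exact rows, and from Rʳ's rows. [cite: Balaban1988Convergent, (0.4) p.235 (bookkeeping)] -/
theorem window_of_runRowsCont13 (θ : Node00.Stage13HParams F 2) (hP : θ.Provisos₁₃SepCoPH F 2) (hrows : RunRowsCont13 F θ) :
    Window (Node00.datumOfRecord₁₃SepCoPH F 2 θ hP) :=
  window_of_runRowsWin13 θ hP (runRowsWin13_of_runRowsEndExact13 θ (runRowsEndExact13_of_runRowsCont13 θ hrows))

/-! ### The K1⁸ displays and their `closes` (K0⁷, K3⁷ VERBATIM; three binders each) -/

/-- plan g84's K1⁸ `StabilityBRunRowsAtRecordR13SepCoPH`, VERBATIM from `Sketch26R.lean` l.56–59 (`K1R8`). [cite: Balaban1989LargeFieldII, Thm 1 p.355; Balaban1987RG1, Thm 3 p.264 (bookkeeping)] -/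
def K1R8 : Prop :=
  ∀ F : T4Family, Inhabited13 F → ∃ (θ : Node00.Stage13HParams F 2) (h : θ.Provisos₁₃SepCoPH F 2),
    (θ.ZhUnity F 2 ∧ θ.SlotsNondegenerate₁₃ F 2) ∧ θ.Admissible F 2 ∧ B16.EndStatementBPrinted (Node00.datumOfRecord₁₃SepCoPH F 2 θ h).C ∧
    Window (Node00.datumOfRecord₁₃SepCoPH F 2 θ h) ∧ RunRowsCont13 F θ

/-- **K1⁸ IN END-EXACT DISPLAY** (offer (b) of the audit): unity ∕ slots ∕ admissible ∕ (B) as in K1⁷, and the END-exact rows; NO separate `Window` conjunct (implied, `window_of_runRowsWin13`). [cite: Balaban1989LargeFieldII, Thm 1 p.355; Balaban1987RG1, Thm 3 p.264 (bookkeeping)] -/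
def K1R8EndExact : Prop :=
  ∀ F : T4Family, Inhabited13 F → ∃ (θ : Node00.Stage13HParams F 2) (h : θ.Provisos₁₃SepCoPH F 2),
    (θ.ZhUnity F 2 ∧ θ.SlotsNondegenerate₁₃ F 2) ∧ θ.Admissible F 2 ∧ B16.EndStatementBPrinted (Node00.datumOfRecord₁₃SepCoPH F 2 θ h).C ∧ RunRowsEndExact13 F θ

/-- **K1⁸ IN END-MINIMAL DISPLAY** (ceiling-free): unity ∕ slots ∕ admissible ∕ (B), and the END-minimal rows {window runs of every length, (iv), (C)}. [cite: Balaban1989LargeFieldII, Thm 1 p.355; Balaban1987RG1, Thm 2 p.259 (first sentence) (bookkeeping)] -/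
def K1R8Win : Prop :=
  ∀ F : T4Family, Inhabited13 F → ∃ (θ : Node00.Stage13HParams F 2) (h : θ.Provisos₁₃SepCoPH F 2),
    (θ.ZhUnity F 2 ∧ θ.SlotsNondegenerate₁₃ F 2) ∧ θ.Admissible F 2 ∧ B16.EndStatementBPrinted (Node00.datumOfRecord₁₃SepCoPH F 2 θ h).C ∧ RunRowsWin13 F θ

/-- Rʳ's K1⁸ ⟹ the END-exact K1⁸ (drop the window conjunct, weaken the rows). [cite: Balaban1989LargeFieldII, Thm 1 p.355 (bookkeeping)] -/
theorem k1R8EndExact_of_k1R8 (h : K1R8) : K1R8EndExact := by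
  intro F hF
  obtain ⟨θ, hP, hU, hθ, hb, -, hrows⟩ := h F hF
  exact ⟨θ, hP, hU, hθ, hb, runRowsEndExact13_of_runRowsCont13 θ hrows⟩

/-- the END-exact K1⁸ ⟹ the END-minimal K1⁸. [cite: Balaban1989LargeFieldII, Thm 1 p.355 (bookkeeping)] -/
theorem k1R8Win_of_k1R8EndExact (h : K1R8EndExact) : K1R8Win := by
  intro F hF
  obtain ⟨θ, hP, hU, hθ, hb, hrows⟩ := h F hF
  exact ⟨θ, hP, hU, hθ, hb, runRowsWin13_of_runRowsEndExact13 θ hrows⟩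

/-- even the END-minimal K1⁸ is STRONGER than K1⁷ as filed (the window comes back from the rows): no display loses K1⁷. [cite: Balaban1989LargeFieldII, Thm 1 p.355; Balaban1988Convergent, (0.4) p.235 (bookkeeping)] -/
theorem stabilityBAtRecordR13SepCoPH_of_k1R8Win (h : K1R8Win) : StabilityBAtRecordR13SepCoPH := by
  intro F hF
  obtain ⟨θ, hP, hU, hθ, hb, hrows⟩ := h F hF
  exact ⟨θ, hP, hU, hθ, hb, window_of_runRowsWin13 θ hP hrows⟩

/-- ★ **THE RUNG FROM THREE BINDERS WITH THE END-MINIMAL K1⁸** (K0⁷ `Record13SepCoPHInhabited` and K3⁷ `SpineGivenEndpointR13SepCoPH` VERBATIM): the same logic as `Sketch26R.closes26R`, the END supplied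
by §2's ceiling-free theorem.  Pure logic over the items + `Node00.isDatumOfRecord₀_datumOfRecord₁₃SepCoPH`. [cite: Balaban1989LargeFieldII, Thm 1 p.355; Balaban1987RG1, Thm 2 p.259 (bookkeeping)] -/
theorem closesWin (h0 : Record13SepCoPHInhabited) (h1 : K1R8Win) (h3 : SpineGivenEndpointR13SepCoPH) :
    Summit.QuantumFields.YangMills.Theses.BalabanLadder.UV := by
  intro F
  obtain ⟨θ, h, hU, hθ, hb, hrows⟩ := h1 F (h0 F)
  have hend : EndpointExistence (Node00.datumOfRecord₁₃SepCoPH F 2 θ h).C.toB12 := endpointExistence_datumOfRecord₁₃SepCoPH_of_runRowsWin13 θ h hrows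
  exact ⟨Node00.datumOfRecord₁₃SepCoPH F 2 θ h, Node00.isDatumOfRecord₀_datumOfRecord₁₃SepCoPH F 2 θ h, hb, hend, h3 F θ h hU hθ hb hend⟩

/-- … with the END-exact K1⁸ … [cite: Balaban1989LargeFieldII, Thm 1 p.355; Balaban1987RG1, Thm 2 p.259 (bookkeeping)] -/
theorem closesEndExact (h0 : Record13SepCoPHInhabited) (h1 : K1R8EndExact) (h3 : SpineGivenEndpointR13SepCoPH) :
    Summit.QuantumFields.YangMills.Theses.BalabanLadder.UV :=
  closesWin h0 (k1R8Win_of_k1R8EndExact h1) h3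

/-- … and with Rʳ's K1⁸ (= `Sketch26R.closes26R`, re-derived through the weaker displays: the over-displayed conjuncts are provably idle for `closes`). [cite: Balaban1989LargeFieldII, Thm 1 p.355; Balaban1987RG1, Thm 2 p.259 (bookkeeping)] -/
theorem closes26R_again (h0 : Record13SepCoPHInhabited) (h1 : K1R8) (h3 : SpineGivenEndpointR13SepCoPH) :
    Summit.QuantumFields.YangMills.Theses.BalabanLadder.UV :=
  closesEndExact h0 (k1R8EndExact_of_k1R8 h1) h3

/-! ### F-B: the (C)-stub in the skeleton's own ∃→∃ idiom, and `Cont13All` ⟹ it -/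

/-- plan g84's ∀θ (C)-letter, VERBATIM from `Sketch26R.lean` l.49–51 (`Cont13All`; the announced third stub `stub_cont13` of K1 v7ᴿ): survivor continuity of the record's β at EVERY admissible
Stage-13 tuple with provisos and EVERY level `γ₀ ≤ θ.γ`.  (The record's β is `betaOfMerged (betaMerged …) (beta0OfMerged …) θ.γ`, whose merged β is the second moment of a `limUnder`-valued
kernel `Node00.polLimit` — continuity in the history is an ESTIMATE of print, [I] §1 pp.263–264, asserted there without proof; nothing makes it hold by construction.) [cite: Balaban1987RG1, §1 pp.263–264 and (1.21)–(1.22) p.264 (bookkeeping)] -/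
def Cont13All : Prop :=
  ∀ (F : T4Family) (θ : Node00.Stage13HParams F 2), θ.Provisos₁₃SepCoPH F 2 → θ.Admissible F 2 →
    ∀ γ₀ : ℝ, 0 < γ₀ → γ₀ ≤ θ.γ → SurvCont (Node00.betaOfRecord₁₃ F 2 θ.toStage13Params) γ₀

/-- **rung 2‴ (proposed text of the third stub's CONCLUSION, ∃-side)**: v6's rung-2″ text `RunRowsAtSomeRecord13PWS F` VERBATIM with ONE more conjunct — (C) `SurvCont β_θ γ₀` AT THE SAME witness
`(θ, h, w)` and THE SAME level `γ₀` as the rows.  The stub `∀ F, RunRowsAtSomeRecord13PWS F → RunRowsContAtSomeRecord13PWS F` asks continuity only where the K1 witness lives. [cite: Balaban1987RG1, Thm 3 p.264, (1.20)–(1.22) p.264, (5.10) p.293, §1 pp.263–264; Balaban1988RG2Cluster, (2.41) p.21 (bookkeeping)] -/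
def RunRowsContAtSomeRecord13PWS (F : T4Family) : Prop :=
  ∃ (θ : Node00.Stage13HParams F 2) (h : θ.Provisos₁₃SepCoPH F 2) (w : WorldP), (θ.ZhUnity F 2 ∧ θ.SlotsNondegenerate₁₃ F 2) ∧ θ.Admissible F 2 ∧
    RecordS F θ h w ∧ (∀ P : B12.RunParams, Nodes (leavesP w P)) ∧
    ∃ (b : ℕ → ℝ) (r γ₀ B M : ℝ), 0 < γ₀ ∧ RunConstRemainder (Node00.betaOfRecord₁₃ F 2 θ.toStage13Params) b r γ₀ ∧ (∀ k, b k ≤ B) ∧ B + r ≤ w.βup ∧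
      (∀ (n : ℕ) (gs : ℕ → ℝ), RGEqH n (Node00.betaOfRecord₁₃ F 2 θ.toStage13Params) gs → Step.InInterval γ₀ n gs →
        ∀ k, k ≤ n → -M ≤ ∑ j ∈ Finset.Ico k n, Node00.betaOfRecord₁₃ F 2 θ.toStage13Params j (prefixOf gs j)) ∧
      SurvCont (Node00.betaOfRecord₁₃ F 2 θ.toStage13Params) γ₀

/-- ★ **K1⁸ (Rʳ VERBATIM) BY NAME FROM THE TWO v6 STUB TEXTS AND THE ∃→∃ (C)-STUB** — `h₁` = `stub_nodes13PWS`, `h₂` = `stub_runRows13PWS`, `h₃` = the proposed `stub_cont13 : ∀ F, RunRowsAtSomeRecord13PWS F →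
RunRowsContAtSomeRecord13PWS F`: (B) + window by `K1EndOfNodes13PWSOfRunRemAt.stabilityB_body_of_rung1At_of_runLetters` (p598782 §2) exactly as v6 composes, rows + (C) read off the bundle.
So the ∃→∃ cut COMPOSES; CONDITIONAL on the three texts; K1⁸ NOT closed. [cite: Balaban1989LargeFieldII, Thm 1 p.355 + (0.1) pp.355–356; Balaban1987RG1, Thm 3 p.264, (5.10) p.293, §1 pp.263–264 (bookkeeping)] -/
theorem k1R8_of_stubTexts_contExists
    (h₁ : ∀ F : T4Family, Inhabited13 F → NodesAtSomeRecord13PWS F)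
    (h₂ : ∀ F : T4Family, NodesAtSomeRecord13PWS F → RunRowsAtSomeRecord13PWS F)
    (h₃ : ∀ F : T4Family, RunRowsAtSomeRecord13PWS F → RunRowsContAtSomeRecord13PWS F) : K1R8 := by
  intro F hinh
  obtain ⟨θ, h, w, hU, hθ, hR, hnodes, b, r, γ₀, B, M, hγ₀, hrem, hB, hmatch, hps, hsc⟩ := h₃ F (h₂ F (h₁ F hinh))
  obtain ⟨hU', hθ', hb, hwin⟩ := stabilityB_body_of_rung1At_of_runLetters θ h w hU hθ hR hnodes hγ₀ hrem hB hmatch hps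
  exact ⟨θ, h, hU', hθ', hb, hwin, b, r, γ₀, M, hγ₀, hrem, hps, hsc⟩

/-- **`Cont13All` ⟹ THE ∃→∃ STUB** (so the ∃→∃ cut is WEAKER than the announced ∀θ letter and loses nothing the plan's `k1R8_of_stubTexts_cont` had): at a rows witness `(θ, h, w)` read (C) at the
admissible PRESENTING tuple `θ'` of `RecordS` (same datum ⟹ same β of record, `Node00.βfun_datumOfRecord₁₃SepCoPH`) at the level `γ₁ := min γ₀ w.γ ≤ θ'.γ`, and cut the rows to `γ₁`
(`RunConstRemainder.mono`, `runwisePS_mono`) — the computation of `Sketch26R.k1R8_of_stubTexts_cont`, relocated into the stub. [cite: Balaban1989LargeFieldII, Thm 1 + (0.1) pp.355–356; Balaban1987RG1, §1 pp.263–264 (bookkeeping)] -/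
theorem stubCont13_of_cont13All (hC : Cont13All) : ∀ F : T4Family, RunRowsAtSomeRecord13PWS F → RunRowsContAtSomeRecord13PWS F := by
  intro F hrows
  obtain ⟨θ, h, w, hU, hθ, hR, hnodes, b, r, γ₀, B, M, hγ₀, hrem, hB, hmatch, hps⟩ := hrows
  obtain ⟨θ', h', hθ'adm, hD, hC', ⟨hwγ, hwγle⟩, hL, hup⟩ := hR
  have hγ₁ : 0 < min γ₀ w.γ := lt_min hγ₀ hwγ
  have hγ₁le : min γ₀ w.γ ≤ θ'.γ := (min_le_right _ _).trans hwγle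
  have hβ : Node00.betaOfRecord₁₃ F 2 θ'.toStage13Params = Node00.betaOfRecord₁₃ F 2 θ.toStage13Params := by
    have := congrArg (fun D => D.βfun) hD
    simpa [Node00.βfun_datumOfRecord₁₃SepCoPH] using this.symm
  have hsc : SurvCont (Node00.betaOfRecord₁₃ F 2 θ.toStage13Params) (min γ₀ w.γ) := by
    have := hC F θ' h' hθ'adm (min γ₀ w.γ) hγ₁ hγ₁le
    rwa [hβ] at this
  exact ⟨θ, h, w, hU, hθ, ⟨θ', h', hθ'adm, hD, hC', ⟨hwγ, hwγle⟩, hL, hup⟩, hnodes, b, r, min γ₀ w.γ, B, M, hγ₁, hrem.mono (min_le_left _ _), hB, hmatch,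
    runwisePS_mono (min_le_left _ _) hps, hsc⟩

end Record

/-! ## §4 NEGATIVE: K1⁷'s WEAK window + (iv) + (C) do NOT give the END — the all-`K` window runs (or a ceiling producing them) are what the END reads -/

section Negative

/-- The kernel witness: `β_2(g_0, g_1) := g_0⁻²` (index shift: `β 1`), every other `β_k :≡ 0`.  Along every genuine run `g_1 = g_0`, so the step producing `g_2` reads `g_1⁻² − g_0⁻² = 0` and halts:
NO in-window run of length `2` exists anywhere, while runs of length `1` exist in every window. [folklore] -/
def betaKill2 : HBeta := fun k v => if k = 1 then 1 / (v 0) ^ 2 else 0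

theorem betaKill2_zero (v : Fin 1 → ℝ) : betaKill2 0 v = 0 := by simp [betaKill2]

theorem betaKill2_one (v : Fin 2 → ℝ) : betaKill2 1 v = 1 / (v 0) ^ 2 := by simp [betaKill2]

theorem betaKill2_nonneg (k : ℕ) (v : Fin (k + 1) → ℝ) : 0 ≤ betaKill2 k v := by
  unfold betaKill2; split_ifs <;> positivity

/-- the length-1 run from `g₀ > 0`: `g_1 = g_0`. [folklore] -/
theorem genSeq_betaKill2_one {g0 : ℝ} (hg0 : 0 < g0) : genSeq betaKill2 g0 1 = g0 := by
  rw [genSeq_succ, genSeq_zero, betaKill2_zero, sub_zero, solveCoupling, if_pos (by positivity : (0 : ℝ) < 1 / g0 ^ 2)]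
  rw [show (1 : ℝ) / g0 ^ 2 = (1 / g0) ^ 2 by ring, Real.sqrt_sq (by positivity), one_div_one_div]

/-- … and the killed second step: `g_2 = 0`. [folklore] -/
theorem genSeq_betaKill2_two {g0 : ℝ} (hg0 : 0 < g0) : genSeq betaKill2 g0 2 = 0 := by
  rw [genSeq_succ, genSeq_betaKill2_one hg0, betaKill2_one]
  have e : prefixOf (genSeq betaKill2 g0) 1 0 = g0 := by rw [prefixOf_apply, Fin.val_zero, genSeq_zero]
  rw [e, sub_self, solveCoupling, if_neg (lt_irrefl 0)]

/-- ★ **K1⁷'s WEAK WINDOW + ROW (iv) + (C) ⇏ THE END.**  For `betaKill2` at any level `γ₀ > 0`: (iv) the run-wise partial-sum floor with `M := 0` (every `β_k ≥ 0`), (C) survivor continuity (the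
only non-constant trace is `x ↦ x⁻²` on `]0, γ₀]`, by `clampPrefix_zero`), and K1⁷'s `Window` shape at the canonical construction — «for every `γ ∈ ]0, γ₀]` SOME run of SOME length `K ≥ 1` lies
in `]0, γ]`» (the run `⟨1, 0, γ⟩`) — all hold, yet `modelOf betaKill2` has NO `EndpointExistence` (no run of length `2` has `g_2 > 0`).  So for the END the window letter must be §2's ALL-`K`
window runs (or §1's per-level ceiling which produces them); K1⁷'s displayed `Window D` is a non-vacuity guard for (B), not an END input.  Complements the tree's
`…K1WindowKOfRunRowsSurvivors.runRows_without_cont_not_endpointExistence` ∕ `runRows_without_floor_not_endpointExistence`. [folklore] -/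
theorem weakWindow_floor_survCont_not_endpointExistence :
    ∃ (β : HBeta) (γ₀ M : ℝ), 0 < γ₀ ∧
      (∀ (n : ℕ) (gs : ℕ → ℝ), RGEqH n β gs → Step.InInterval γ₀ n gs → ∀ k, k ≤ n → -M ≤ ∑ j ∈ Finset.Ico k n, β j (prefixOf gs j)) ∧
      SurvCont β γ₀ ∧
      (∀ γ : ℝ, 0 < γ → γ ≤ γ₀ → ∃ P : B12.RunParams, 1 ≤ P.K ∧ ((modelOf β) P).flow.InInterval γ P.K) ∧
      ¬ EndpointExistence (modelOf β) := by
  refine ⟨betaKill2, 1, 0, one_pos, ?_, ?_, ?_, ?_⟩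
  · -- (iv): every β ≥ 0
    intro n gs _ _ k _
    rw [neg_zero]
    exact Finset.sum_nonneg fun j _ => betaKill2_nonneg j _
  · -- (C): traces are `0` except at `k = 1`, where the trace is `x ↦ x⁻²` on the survivor set `⊆ ]0, 1]`
    intro k
    by_cases hk : k = 1
    · subst hk
      have hsub : Survivors betaKill2 1 1 ⊆ {x : ℝ | 0 < x ∧ x ≤ 1} := fun x hx => ⟨hx.1, hx.2.1⟩
      refine ContinuousOn.mono ?_ hsub
      have hcont : ContinuousOn (fun x : ℝ => 1 / x ^ 2) {x : ℝ | 0 < x ∧ x ≤ 1} :=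
        continuousOn_const.div (continuousOn_pow 2) fun x hx => pow_ne_zero 2 hx.1.ne'
      refine hcont.congr fun x hx => ?_
      show betaKill2 1 (clampPrefix betaKill2 1 1 x) = 1 / x ^ 2
      rw [betaKill2_one, clampPrefix_zero 1 hx.1 hx.2]
    · have e : (fun x : ℝ => betaKill2 k (clampPrefix betaKill2 1 k x)) = fun _ => 0 := by
        funext x; simp [betaKill2, hk]
      rw [e]; exact continuousOn_const
  · -- the weak window: the run `⟨1, 0, γ⟩` has `g_0 = g_1 = γ`
    intro γ hγ hγ1
    refine ⟨⟨1, 0, γ⟩, le_rfl, fun k hk => ?_⟩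
    show 0 < genSeq betaKill2 γ k ∧ genSeq betaKill2 γ k ≤ γ
    interval_cases k
    · rw [genSeq_zero]; exact ⟨hγ, le_rfl⟩
    · rw [genSeq_betaKill2_one hγ]; exact ⟨hγ, le_rfl⟩
  · -- no END: at `K = 2` every run has `g_2 = 0`
    intro hE
    obtain ⟨γ₂, hγ₂, h⟩ := hE 0
    obtain ⟨gstar, hg, h⟩ := h γ₂ hγ₂ le_rfl
    obtain ⟨g0, hI, hend⟩ := h gstar hg le_rfl 2
    have hg0 : 0 < g0 := by
      have := (hI 0 (Nat.zero_le _)).1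
      change 0 < genSeq betaKill2 g0 0 at this
      rwa [genSeq_zero] at this
    have h2 : genSeq betaKill2 g0 2 = gstar := hend
    rw [genSeq_betaKill2_two hg0] at h2
    exact absurd h2 hg.ne
end Negative

end Summit.QuantumFields.YangMills.Cruxes.EndpointGivenBR13SepCoPH.Idea4g12

end
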